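import Summits.HubbardSuperconductivity.HubbardSuperconductivity.Theorems.AnisotropyChordChordXYTangentBound

/-!
# Route `AnisotropyChord`, crux `ChordXY` (stmt-HubbardSuperconductivity-8146), line `doob-johnson-chord`:
# the TWO-STATE IDENTITY — the exact slack of the AM–GM tangent bound is a Dirichlet form

For a square complex matrix `O` with entries in `ℝ≥0` and `O j i = O i j`, a real `ψ ≥ 0` and a complex
amplitude `φ` supported inside `{ψ > 0}`, the slack in the tangent bound
`Re⟨φ, Oφ⟩ ≤ Σ_i ‖φ i‖² · Re((Oψ) i)/ψ i` (`re_star_dotProduct_mulVec_le_sum_norm_sq_mul_field`, the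
landed stub `stub_tangentBound` of the line) is EXACTLY the Dirichlet form of the `ψ`-Doob-transformed
"teleport" kernel `O_ij ψ_i ψ_j` evaluated at the ratio `φ/ψ`:

* `two_state_identity` —
  `Σ_i ‖φ i‖² Re((Oψ) i)/ψ i − Re⟨φ, Oφ⟩ = ½ Σ_i Σ_j Re(O i j) ψ_i ψ_j ‖φ_i/ψ_i − φ_j/ψ_j‖²`.

With `O = S⁺_tot S⁻_tot`, `ψ = ψ_Δ` (Perron ground state at `Δ`) and `φ = ψ₀` (XY ground state) this is the
AM–GM PENALTY separating the frozen-field chord `C⁺ = stub_frozenFieldChord` from the crux: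
`(1+Δ)·E_{|ψ₀|²}[g_Δ] − (1+Δ)·Λ(ψ₀) = (1+Δ)·ℰ^{ψ_Δ}_tele(ψ₀/ψ_Δ)` (line card `Lines/doob_johnson_chord.md`,
support S1; measured ≤ 2 % of the chord's slack at N ≤ 20).  Folklore (Doob 1957 h-transform; the
"two-state"/ground-state-transformation identity of variational Monte Carlo); no definition is introduced;
sorry-free.  HONEST: a support identity; nothing here proves `ChordXY`; superconductivity in the Hubbard
model is not advanced.
-/

set_option linter.dupNamespace false

noncomputable section

namespace Summit.HubbardSuperconductivity.HubbardSuperconductivity.Theorems.AnisotropyChord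

open Matrix Complex Finset
open scoped ComplexOrder ComplexConjugate

/-- The per-pair algebra of the two-state identity: for `p, q ≥ 0` with `a ≠ 0 → p > 0`, `b ≠ 0 → q > 0`,
`p q ‖a/p − b/q‖² = q‖a‖²/p + p‖b‖²/q − 2 Re(ā b)` (Lean's `x/0 = 0` makes the degenerate cases
consistent). [folklore] -/
theorem two_state_pair (a b : ℂ) (p q : ℝ) (hp : 0 ≤ p) (hq : 0 ≤ q) (hap : a ≠ 0 → 0 < p)
    (hbq : b ≠ 0 → 0 < q) :
    p * q * ‖a / (p : ℂ) - b / (q : ℂ)‖ ^ 2 =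
      ‖a‖ ^ 2 * q / p + ‖b‖ ^ 2 * p / q - 2 * (conj a * b).re := by
  have hnorm : ∀ u v : ℂ, ‖u - v‖ ^ 2 = ‖u‖ ^ 2 + ‖v‖ ^ 2 - 2 * (conj u * v).re := by
    intro u v
    rw [← Complex.normSq_eq_norm_sq, ← Complex.normSq_eq_norm_sq, ← Complex.normSq_eq_norm_sq,
      Complex.normSq_sub]
    congr 1
    rw [Complex.mul_re, Complex.conj_re, Complex.conj_im, Complex.mul_re, Complex.conj_re, Complex.conj_im]
    ring
  by_cases ha : a = 0
  · subst ha
    by_cases hb : b = 0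
    · subst hb; simp
    · have hq' : 0 < q := hbq hb
      by_cases hp0 : p = 0
      · subst hp0; simp
      · have hp' : 0 < p := lt_of_le_of_ne hp (Ne.symm hp0)
        rw [zero_div, zero_sub, norm_neg, norm_div, Complex.norm_real, Real.norm_eq_abs, abs_of_pos hq',
          map_zero, zero_mul, Complex.zero_re, mul_zero, sub_zero, norm_zero]
        field_simp
        ring
  · have hp' : 0 < p := hap ha
    by_cases hb : b = 0
    · subst hb
      rw [zero_div, sub_zero, norm_div, Complex.norm_real, Real.norm_eq_abs, abs_of_pos hp', mul_zero,
        Complex.zero_re, mul_zero, sub_zero, norm_zero]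
      by_cases hq0 : q = 0
      · subst hq0; simp
      · field_simp
        ring
    · have hq' : 0 < q := hbq hb
      rw [hnorm, norm_div, norm_div, Complex.norm_real, Complex.norm_real, Real.norm_eq_abs,
        Real.norm_eq_abs, abs_of_pos hp', abs_of_pos hq']
      have hcross : (conj (a / (p : ℂ)) * (b / (q : ℂ))).re = (conj a * b).re / (p * q) := by
        rw [map_div₀, Complex.conj_ofReal, div_mul_div_comm, ← Complex.ofReal_mul, Complex.div_ofReal_re]
      rw [hcross]
      field_simp

/-- **The two-state identity (exact slack of the AM–GM tangent bound).**  For `O` with entries in `ℝ≥0`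
and `O j i = O i j`, `ψ ≥ 0` real and `φ` supported inside `{ψ > 0}`:
`Σ_i ‖φ i‖² Re((Oψ) i)/ψ i − Re⟨φ, Oφ⟩ = ½ Σ_i Σ_j Re(O i j) ψ_i ψ_j ‖φ_i/ψ_i − φ_j/ψ_j‖²` — the Dirichlet
form of the Doob-transformed kernel at the ratio `φ/ψ`.  Doob (1957); VMC ground-state transformation.
[folklore] -/
theorem two_state_identity {ι : Type*} [Fintype ι] [DecidableEq ι]
    (O : Matrix ι ι ℂ) (hO : ∀ i j, 0 ≤ O i j) (hsymm : ∀ i j, O j i = O i j)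
    (ψ : ι → ℝ) (φ : ι → ℂ) (hψ : ∀ i, 0 ≤ ψ i) (hsupp : ∀ i, φ i ≠ 0 → 0 < ψ i) :
    (∑ i, ‖φ i‖ ^ 2 * (((O *ᵥ fun j => ((ψ j : ℝ) : ℂ)) i).re / ψ i)) - (star φ ⬝ᵥ (O *ᵥ φ)).re =
      (1 / 2) * ∑ i, ∑ j, (O i j).re * (ψ i * ψ j * ‖φ i / (ψ i : ℂ) - φ j / (ψ j : ℂ)‖ ^ 2) := by
  -- the entries of `O` as real numbers
  have hex : ∃ o : ι → ι → ℝ, (∀ i j, o j i = o i j) ∧ ∀ i j, O i j = ((o i j : ℝ) : ℂ) := by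
    refine ⟨fun i j => (O i j).re, fun i j => by
      show (O j i).re = (O i j).re
      rw [hsymm], fun i j => Complex.ext (by simp) ?_⟩
    have h := (Complex.le_def.mp (hO i j)).2
    simp only [Complex.zero_im] at h
    simp [← h]
  obtain ⟨o, ho_symm, hOeq⟩ := hex
  have hore : ∀ i j, (O i j).re = o i j := fun i j => by rw [hOeq, Complex.ofReal_re]
  -- the left side as real double sums
  have hL : (star φ ⬝ᵥ (O *ᵥ φ)).re = ∑ i, ∑ j, o i j * (conj (φ i) * φ j).re := by
    simp only [dotProduct, mulVec, Pi.star_apply, Finset.mul_sum, Complex.re_sum]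
    refine Finset.sum_congr rfl fun i _ => Finset.sum_congr rfl fun j _ => ?_
    rw [hOeq, Complex.star_def]
    have h : conj (φ i) * (((o i j : ℝ) : ℂ) * φ j) = ((o i j : ℝ) : ℂ) * (conj (φ i) * φ j) := by ring
    rw [h, Complex.re_ofReal_mul]
  have hR : ∑ i, ‖φ i‖ ^ 2 * (((O *ᵥ fun j => ((ψ j : ℝ) : ℂ)) i).re / ψ i) =
      ∑ i, ∑ j, o i j * (‖φ i‖ ^ 2 * ψ j / ψ i) := by
    refine Finset.sum_congr rfl fun i _ => ?_
    have h1 : ((O *ᵥ fun j => ((ψ j : ℝ) : ℂ)) i).re = ∑ j, o i j * ψ j := by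
      simp only [mulVec, dotProduct, Complex.re_sum]
      refine Finset.sum_congr rfl fun j _ => ?_
      rw [hOeq, ← Complex.ofReal_mul, Complex.ofReal_re]
    rw [h1, Finset.sum_div, Finset.mul_sum]
    refine Finset.sum_congr rfl fun j _ => ?_
    ring
  -- the right side, pair by pair
  have hP : ∑ i, ∑ j, (O i j).re * (ψ i * ψ j * ‖φ i / (ψ i : ℂ) - φ j / (ψ j : ℂ)‖ ^ 2) =
      ∑ i, ∑ j, o i j * (‖φ i‖ ^ 2 * ψ j / ψ i) + ∑ i, ∑ j, o i j * (‖φ j‖ ^ 2 * ψ i / ψ j) -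
        2 * ∑ i, ∑ j, o i j * (conj (φ i) * φ j).re := by
    rw [Finset.mul_sum, ← Finset.sum_add_distrib, ← Finset.sum_sub_distrib]
    refine Finset.sum_congr rfl fun i _ => ?_
    rw [Finset.mul_sum, ← Finset.sum_add_distrib, ← Finset.sum_sub_distrib]
    refine Finset.sum_congr rfl fun j _ => ?_
    rw [hore, two_state_pair (φ i) (φ j) (ψ i) (ψ j) (hψ i) (hψ j) (hsupp i) (hsupp j)]
    ring
  have hT : ∑ i, ∑ j, o i j * (‖φ j‖ ^ 2 * ψ i / ψ j) = ∑ i, ∑ j, o i j * (‖φ i‖ ^ 2 * ψ j / ψ i) := by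
    rw [Finset.sum_comm]
    refine Finset.sum_congr rfl fun i _ => Finset.sum_congr rfl fun j _ => ?_
    rw [ho_symm i j]
  rw [hL, hR, hP, hT]
  ring

end Summit.HubbardSuperconductivity.HubbardSuperconductivity.Theorems.AnisotropyChord

end
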